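import Summits.Ventures.HodgeRepro2.T6N41PlaceSplit

/-!
# T6N41PlaceKappa — the carriers of the convention character of (A″κ) (Tier 6, M2; definition lane; owner t6-p4)

Layer 4 of the placement: the objects of TIER5 §N4.1.9 (c2)–(c6) and §N4.1.10 (route-1's Lemma A′-4) at a
finite place `v ∉ S` of `F` SPLIT in `E`, over the split datum `Sp : SplitDatum In` (T6N41PlaceSplit).  The
residual `hκ : γ_D(𝔓₁) = μ₂` of `T6N41PlaceSplitMain.satake_split` («`μ₂` is the `w`-component of the global
character `γ_D`») is, in the record's own words, the conjunction of
* (c2)–(c5) [elementary]: the datum's compatible splitting is GR91's `s^{λ_D}` for ONE Hecke character `λ_D` of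
  `E` with `λ_D|_{𝔸_F^×} = ω_{E/F}` (GR91 Prop. 3.1.1 / Remark p. 457 ll. 4–7), at a split `v` the `λ`-free section
  `s_v^{1}` and the type-II section `s_II` differ by a character `κ_v ∘ det` of `GL₂(F_v)` (two sections of one
  central `ℂ^×`-extension; `SL₂(F_v)` perfect), so that `μ₂ = λ_{D,w} · κ_v⁻¹` — the field `μ₂_eq`;
* the DEFINITION of `γ_D` (§N4.1.10 (a)/(d1)): `γ_D := λ_D · (κ_F ∘ N_{E/F})⁻¹` with `κ_F := (·, t)_𝔸` the
  quadratic Hecke character of `F` attached to the element `t ∈ F^×` fixed by the printed normalisations (`t = 1`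
  as GR91 print (3.1.2)/(3.1.3); `t = 2` under Rao's `η = ½ψ` reading) — at `𝔓₁ = w` the norm is the identity on
  the `w`-factor, so `γ_D(ϖ_w) = λ_D(ϖ_w) · (ϖ_v, t)_v⁻¹` — the field `γD_def`;
* Lemma A′-4 (b4)–(b6): `κ_v(a) = κ′(a)⁻¹` with `κ′(a) := γ_F(a, ψ_v) · γ_F(a, η)⁻¹`, `η = tψ_v`, the quotient of the
  Weil-index factors of GR91 (3.1.2) (`γ_v(N(k))`, MVW's `β(K)`) and of (3.1.3) (Rao's `m(K_a) = γ_F(x(K_a), η)⁻¹`),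
  read on the torus element `K_a` through the intertwiner between GR91's Schrödinger model on `L²(W₁)` and the
  type-II model on `𝒮(X)` — NOT formalised (two Schrödinger models + the partial Fourier transform + Stone–von
  Neumann): it stays the residual BINDER `hκ'` of `T6N41PlaceKappaMain.kappa_eq_hilbert`, evaluated at `a = ϖ_v`;
* Rao 1993 Corollary A.5 (1), `γ_F(a, cη) = (a, c)_F γ_F(a, η)` — the DISPLAY of `T6N41PlaceKappaHyp.lean`, which
  turns `κ′(ϖ_v)⁻¹` into the Hilbert symbol `(ϖ_v, t)_v` and so closes `γ_D(𝔓₁) = μ₂` in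
  `T6N41PlaceKappaMain.hκ_of_kappa`.

The carriers: `Fx v` = the elements of `F_v^×` (abstract), `AddCh v` = the nontrivial continuous characters of
`(F_v, +)` (Rao §A.3), `smul v a η = aη : x ↦ η(ax)`, `hilbert v a b = (a, b)_{F_v}` the Hilbert symbol (Rao
Thm A.4: `+1` if `a` is a norm in `F(√b)`, `−1` otherwise), `γF v a η = γ_F(a, η) = γ_F(aη)/γ_F(η)` the quotient of
Weil indices (Rao §A.3 p. 367) — both valued in `ℂˣ`; `ϖ v` a uniformiser, `ψ v` the datum's additive character,
`t v` the image of the global `t`, `lam 𝔓 = λ_D(ϖ_𝔓)`, `κv v = κ_v(ϖ_v)`.  Nothing about the globality of `t`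
or `λ_D` is a kernel object (the carriers hold values at uniformisers); what the layer makes visible is that the
residual of the placement is the LOCAL, convention-level identity `hκ'`, and that the step from it to
`γ_D(𝔓₁) = μ₂` is Rao's Corollary A.5 (1) plus the two definitional links.

§8(d): uses an L-value-free non-vanishing device: NO.
-/

namespace Summit.Ventures.HodgeRepro2.T6

/-- The carriers of the convention character of (A″κ) over the split datum `Sp`.  Fields are DATA, one
elementary reduction ((c2)–(c5) of TIER5 §N4.1.9) and one definitional link (the definition of `γ_D`,
§N4.1.10 (a)/(d1)); the printed theorem (Rao 1993 Corollary A.5 (1)) is the display of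
`T6N41PlaceKappaHyp.lean`, and the operator comparison of Lemma A′-4 is the residual binder of
`T6N41PlaceKappaMain.lean`. -/
structure KappaDatum {ι : Type*} {D : DoublingLDatum ι} {Pl : PlacementDatum D} {In : InertDatum Pl}
    (Sp : SplitDatum In) where
  /-- the elements of `F_v^×`, the multiplicative group of the local field `F_v` (abstract) -/
  Fx : ι → Type
  /-- the nontrivial continuous characters `η` of `(F_v, +)` (Rao 1993 §A.3, p. 367 l. 1) -/
  AddCh : ι → Type
  /-- `(a, η) ↦ aη`, «the character `aη : x → η(ax)`» (Rao §A.3, p. 367 l. 2) -/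
  smul : ∀ v, Fx v → AddCh v → AddCh v
  /-- the Hilbert symbol `(a, b)_{F_v}` of `F_v` (Rao Thm A.4: «`+1` if `a` is a norm in `F(√b)`, `−1`
  otherwise»), as an element of `ℂˣ` -/
  hilbert : ∀ v, Fx v → Fx v → ℂˣ
  /-- Rao's `γ_F(a, η) = γ_F(aη)/γ_F(η)`, the quotient of the Weil indices of `x ↦ η(ax²)` and `x ↦ η(x²)`
  (§A.3, p. 367 ll. 3–4), as an element of `ℂˣ` -/
  γF : ∀ v, Fx v → AddCh v → ℂˣ
  /-- a uniformiser `ϖ_v` of `F_v` -/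
  ϖ : ∀ v, Fx v
  /-- the datum's additive character `ψ_v` of `F_v` (the one of the Weil representation `ω_{W_A, V′, χ, v}`) -/
  ψ : ∀ v, AddCh v
  /-- the image in `F_v^×` of the element `t ∈ F^×` fixed by the printed normalisations of GR91 (3.1.2) /
  (3.1.3) (TIER5 §N4.1.10 (a): `t = 1` as printed, `t = 2` under Rao's `η = ½ψ` reading of (3.1.3); ONE global
  element, the same at every `v`) -/
  t : ∀ v, Fx v
  /-- `λ_D(ϖ_𝔓)`: the value at the uniformiser of the Hecke character `λ_D` of `E` with `λ_D|_{𝔸_F^×} = ω_{E/F}`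
  that parametrises the datum's compatible splitting (GR91 Prop. 3.1.1, (3.1.2), Remark p. 457 ll. 4–7; TIER5
  §N4.1.9 (c2)) -/
  lam : Pl.κ → ℂˣ
  /-- `κ_v(ϖ_v)`: the value at the uniformiser of the convention character `κ_v` of `F_v^×` by which the type-II
  section differs from GR91's `λ`-free section: `s_II = s_v^{1} ⊗ (κ_v ∘ det)` (TIER5 §N4.1.9 (c5); unramified at
  `v ∉ S`) -/
  κv : ι → ℂˣ
  /-- [elementary (c2)–(c5) of TIER5 §N4.1.9] at every split `v ∉ S` the `GL₂`-side twist of the datum's Weil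
  representation relative to Mínguez's model is `μ₂ = λ_{D,w} · κ_v⁻¹` (`s_v^{λ_D} = s_v^{1} ⊗ (λ_{D,w} ∘ det)` by
  the evaluation (c4) of (3.1.2) at a split place, `s_II = s_v^{1} ⊗ (κ_v ∘ det)` by (c5)) -/
  μ₂_eq : ∀ v, Sp.splitPlace v → v ∉ D.S → Sp.μ₂ v = lam (Sp.p₁ v) * (κv v)⁻¹
  /-- [definitional; TIER5 §N4.1.10 (a)/(d1)] `γ_D := λ_D · (κ_F ∘ N_{E/F})⁻¹` with `κ_F := (·, t)_𝔸`: at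
  `𝔓₁ = w` the norm `N_{E/F}` is the identity on the `w`-factor of `E_v = F_v × F_v`, so
  `γ_D(ϖ_w) = λ_D(ϖ_w) · (ϖ_v, t)_v⁻¹` -/
  γD_def : ∀ v, Sp.splitPlace v → v ∉ D.S →
    In.γD (Sp.p₁ v) = lam (Sp.p₁ v) * (hilbert v (ϖ v) (t v))⁻¹

namespace KappaDatum

variable {ι : Type*} {D : DoublingLDatum ι} {Pl : PlacementDatum D} {In : InertDatum Pl}
  {Sp : SplitDatum In} (Kd : KappaDatum Sp)

/-- The Weil-index quotient `κ′(a) := γ_F(a, ψ_v) · γ_F(a, tψ_v)⁻¹` of TIER5 §N4.1.10 Lemma A′-4 (b4), at the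
uniformiser `a = ϖ_v`: the ratio of the normalising factors of GR91 (3.1.2) and (3.1.3) on the torus element
`K_{ϖ_v}`. -/
noncomputable def κ' (v : ι) : ℂˣ :=
  Kd.γF v (Kd.ϖ v) (Kd.ψ v) * (Kd.γF v (Kd.ϖ v) (Kd.smul v (Kd.t v) (Kd.ψ v)))⁻¹

end KappaDatum

end Summit.Ventures.HodgeRepro2.T6
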